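import Summits.ValiantsHypothesis.ValiantsHypothesis.Theorems.NewtonUnitEquationsTwoProductsRankOneFourLawFibres
import HarnessLib

/-!
# Route NewtonUnitEquations — crux `TwoProducts` (stmt-ValiantsHypothesis-5906), line `relation_ladder`, rung R6 (four-term
# rank one): the SEGRE LIFT — the PROVED SPLIT `BinExpPencilCount → RankOneFourLaw` — part 3/6 — the slice terms, the coefficient theorem for the Segre lift of the truncated logarithm, and Lemma A upstairs (slice section + Part T5)

(T4, continued) the slice index `SIdx`, tables `tab`, signs `sgn`, the slice terms `termC/termA/termD`, the slice sum `Fsl = bsum …`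
(`bwidth_termD_le`, `term_eval`, `Fsl_xhat_eq`), THE COEFFICIENT THEOREM `coeff_segre_logTrunc` (the coefficient of `Y^x` in the Segre lift of the
truncated logarithm is `(-1)^{n+1}/n · multinomial(x̂) · F_{x_c}(x̂)`), the support criterion `mem_support_segre_logTrunc_iff`, the shape lemma
`shape_of_Fsl_ne_zero`, `Fsl_zero_zero`, and the balanced exponent `xOf I b ν` with prescribed slice (`xOf_c`, `xOf_balanced`, `xhat_xOf`,
`xOf_xhat`); (T5) Lemma A for ANY toric lift: `coeff_zero_phiT_lin`, `phiT_liftG`, `phiT_logTrunc` and `toric_minLog` — a strict `θ`-minimum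
(`θ ≥ 1`) of the support of `φ_M(G)` is a strict `θ`-minimum of the support of `φ_M(Λ_R)`, `R = ⌊θ(x₀)⌋ + 1` (from the tree's generic
`strictMin_sub_iff_of_congr` + `coeff_wronskian_congr`).

PORT NOTE (val-lit-p11 g1, literature-prover seat, helper mode `--supports stmt-ValiantsHypothesis-5906 --as helper`, no stub credit
claimed): part 3/6 of a VERBATIM Theorems-side port of val-idea-8 g3's sorry-free module
`Cruxes/TwoProducts/Lines/relation_ladder_R6.lean` (tree @1dcc86cce347; file sha256 36828fc46563…; 1 653 lines; `lean check` rc 0, 0 sorries)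
into files of ≤ 400 lines, as tasked by the val-lit desk (RULING #273 (b)). ALL mathematics and ALL proofs below are val-idea-8 g3's (engine
memo `Cruxes/TwoProducts/Lines/relation_ladder_R6_engine.md` rev 3); the port changes only: the file split, the import chain, two deprecated
Mathlib names (`Finsupp.coe_finset_sum` → `Finsupp.coe_finsetSum`, `Finsupp.finset_sum_apply` → `Finsupp.finsetSum_apply`), `omit […] in`
annotations and one-line docstrings on 45 API lemmas required by the tree's zero-warning / docstring lint. Namespace = the author's
(`…Theorems.NewtonUnitEquations.TwoProducts.PermutationType`, as in the R3♯ port `…PermutationType{WeightOrder,Lifted,PushForward,Count,Family}`).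
Nothing here closes the line's residual, the crux `TwoProducts` (5906) or `VP ≠ VNP`; no summit statement is proved.

Cut table: in the module docstring of part 1/6 (`…RankOneFourLawToric`); this file = source l. 562–865.

Honest scope (the author's): shapes `α = β + γ` (R6b), `2β = α + γ` (R6c) and coincidence rank `≥ 2` (R7) are NOT covered and go to the
residual of skeleton v14. Nothing here moves VP ≠ VNP; `TwoProducts` (5906) stays OPEN. [folklore]
-/

noncomputable section

-- Sub = Summit single-conjunct layout: the duplicated namespace component is mandated by the tree.
set_option linter.dupNamespace false
set_option linter.unusedSimpArgs false

namespace Summit.ValiantsHypothesis.ValiantsHypothesis.Theorems.NewtonUnitEquations.TwoProducts.PermutationType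
open scoped BigOperators
open MvPolynomial

variable {σ : Type*} [Fintype σ] [DecidableEq σ]

variable (I : FourIdx σ)

section Slice
variable {m : ℕ}

/-- The slice term set: (signed atom, `k = #α`) with `k ≤ b`. [folklore] -/
abbrev SIdx (m b : ℕ) := (Fin m ⊕ Fin m) × Fin (b + 1)

/-- The coefficient table of a signed atom. [folklore] -/
def tab (c d : Fin m → σ → ℂ) : Fin m ⊕ Fin m → σ → ℂ := Sum.elim c d

/-- The sign of a signed atom. [folklore] -/
def sgn (m : ℕ) : Fin m ⊕ Fin m → ℂ := Sum.elim (fun _ => 1) (fun _ => -1)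

/-- Term coefficients of the slice sum: `± c_α^k c_δ^{b-k}`. [folklore] -/
def termC (c d : Fin m → σ → ℂ) (b : ℕ) : SIdx m b → ℂ :=
  fun τ => sgn m τ.1 * (tab c d τ.1 I.a ^ (τ.2 : ℕ) * tab c d τ.1 I.d ^ (b - τ.2))

/-- Term bases of the slice sum: `c_γ` on `Z₁`, `c_β` on `Z₂`, `0` on `W₁, W₂`, `c_e` elsewhere. [folklore] -/
def termA (c d : Fin m → σ → ℂ) (b : ℕ) : SIdx m b → σ → ℂ :=
  fun τ j => if j = I.a then tab c d τ.1 I.c else if j = I.c ∨ j = I.d then 0 else tab c d τ.1 j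

/-- Term binomial degrees of the slice sum: `k` on `Z₁`, `b - k` on `Z₂`, `0` elsewhere. [folklore] -/
def termD (b : ℕ) : SIdx m b → σ → ℕ :=
  fun τ j => if j = I.a then (τ.2 : ℕ) else if j = I.b then b - τ.2 else 0

/-- **The slice sum** `F(b; ·)` of the Segre-lifted truncated logarithm. [folklore] -/
def Fsl (c d : Fin m → σ → ℂ) (b : ℕ) (ν : σ → ℕ) : ℂ :=
  bsum (termC I c d b) (termA I c d b) (termD I b) ν

/-- The width of the slice sum is at most `2 m (b + 1)^3`. [folklore] -/
theorem bwidth_termD_le (b : ℕ) : bwidth (termD I b : SIdx m b → σ → ℕ) ≤ 2 * m * (b + 1) ^ 3 := by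
  unfold bwidth
  have hterm : ∀ τ : SIdx m b, ∏ j, (termD I b τ j + 1) ≤ (b + 1) ^ 2 := by
    intro τ
    rw [prod_four_split I]
    have hr : ∏ j ∈ rest I, (termD I b τ j + 1) = 1 := by
      refine Finset.prod_eq_one fun j hj => ?_
      rw [mem_rest] at hj
      simp [termD, hj.1, hj.2.1]
    rw [hr, one_mul]
    have ha : termD I b τ I.a = (τ.2 : ℕ) := by simp [termD]
    have hb : termD I b τ I.b = b - τ.2 := by simp [termD, I.hab.symm]
    have hc : termD I b τ I.c = 0 := by simp [termD, I.hac.symm, I.hbc.symm]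
    have hd : termD I b τ I.d = 0 := by simp [termD, I.had.symm, I.hbd.symm]
    rw [ha, hb, hc, hd]
    have h2 := τ.2.isLt
    calc ((τ.2 : ℕ) + 1) * ((b - τ.2 + 1) * ((0 + 1) * (0 + 1))) = ((τ.2 : ℕ) + 1) * (b - τ.2 + 1) := by ring
      _ ≤ (b + 1) * (b + 1) := Nat.mul_le_mul (by omega) (by omega)
      _ = (b + 1) ^ 2 := by ring
  calc ∑ τ : SIdx m b, ∏ j, (termD I b τ j + 1) ≤ ∑ _τ : SIdx m b, (b + 1) ^ 2 :=
        Finset.sum_le_sum fun τ _ => hterm τ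
    _ = (2 * m * (b + 1)) * (b + 1) ^ 2 := by
        rw [Finset.sum_const, Finset.card_univ, smul_eq_mul]
        simp [Fintype.card_prod, Fintype.card_sum, Fintype.card_fin]; ring
    _ = 2 * m * (b + 1) ^ 3 := by ring

/-- **Per-term evaluation** of the slice sum at a reduced exponent `x̂` (slice `b = x_c`): the term `(t, k)` equals
`± C(x_a, k) C(x_b, x_c - k) · mom (tab t) (Lof x k)`. [folklore] -/
theorem term_eval (c d : Fin m → σ → ℂ) (x : σ →₀ ℕ) (τ : SIdx m (x I.c)) :
    termC I c d (x I.c) τ * ∏ j, binChar (termA I c d (x I.c) τ j) (termD I (x I.c) τ j) (xhat I x j) =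
      sgn m τ.1 * (((x I.a).choose τ.2 * (x I.b).choose (x I.c - τ.2) : ℕ) : ℂ) * mom (tab c d τ.1) (Lof I x τ.2) := by
  have hk : (τ.2 : ℕ) ≤ x I.c := Nat.lt_succ_iff.mp τ.2.isLt
  unfold mom
  rw [prod_four_split I, prod_four_split I]
  -- the four special factors of the binomial product
  have hAa : termA I c d (x I.c) τ I.a = tab c d τ.1 I.c := by simp [termA]
  have hAb : termA I c d (x I.c) τ I.b = tab c d τ.1 I.b := by simp [termA, I.hab.symm, I.hbc, I.hbd]
  have hAc : termA I c d (x I.c) τ I.c = 0 := by simp [termA, I.hac.symm]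
  have hAd : termA I c d (x I.c) τ I.d = 0 := by simp [termA, I.had.symm]
  have hDa : termD I (x I.c) τ I.a = (τ.2 : ℕ) := by simp [termD]
  have hDb : termD I (x I.c) τ I.b = x I.c - τ.2 := by simp [termD, I.hab.symm]
  have hDc : termD I (x I.c) τ I.c = 0 := by simp [termD, I.hac.symm, I.hbc.symm]
  have hDd : termD I (x I.c) τ I.d = 0 := by simp [termD, I.had.symm, I.hbd.symm]
  rw [hAa, hAb, hAc, hAd, hDa, hDb, hDc, hDd, xhat_a, xhat_b, xhat_c, xhat_d, Lof_a, Lof_b, Lof_c, Lof_d,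
    binChar_base_zero, if_pos rfl]
  -- the remaining factors agree
  have hr : ∏ j ∈ rest I, binChar (termA I c d (x I.c) τ j) (termD I (x I.c) τ j) (xhat I x j) =
      ∏ j ∈ rest I, tab c d τ.1 j ^ (Lof I x τ.2) j := by
    refine Finset.prod_congr rfl fun j hj => ?_
    rw [mem_rest] at hj
    rw [Lof_other I x _ j hj.1 hj.2.1 hj.2.2.1 hj.2.2.2, xhat_other I x j hj.2.2.1 hj.2.2.2]
    have hA : termA I c d (x I.c) τ j = tab c d τ.1 j := by simp [termA, hj.1, hj.2.2.1, hj.2.2.2]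
    have hD : termD I (x I.c) τ j = 0 := by simp [termD, hj.1, hj.2.1]
    rw [hA, hD, binChar_zero_deg]
  rw [hr, show x I.b + (τ.2 : ℕ) - x I.c = x I.b - (x I.c - τ.2) by omega]
  unfold binChar termC
  push_cast
  ring

/-- **The slice sum at a reduced exponent** is the binomially weighted fibre sum of moment differences. [folklore] -/
theorem Fsl_xhat_eq (c d : Fin m → σ → ℂ) (x : σ →₀ ℕ) :
    Fsl I c d (x I.c) (xhat I x) = ∑ k ∈ Finset.range (x I.c + 1),
      (((x I.a).choose k * (x I.b).choose (x I.c - k) : ℕ) : ℂ) *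
        (∑ j, mom (c j) (Lof I x k) - ∑ j, mom (d j) (Lof I x k)) := by
  unfold Fsl bsum
  rw [Fintype.sum_prod_type_right]
  rw [← Fin.sum_univ_eq_sum_range (fun k => (((x I.a).choose k * (x I.b).choose (x I.c - k) : ℕ) : ℂ) *
        (∑ j, mom (c j) (Lof I x k) - ∑ j, mom (d j) (Lof I x k))) (x I.c + 1)]
  refine Finset.sum_congr rfl fun k _ => ?_
  rw [Fintype.sum_sum_type]
  simp only [term_eval]
  simp only [sgn, tab, Sum.elim_inl, Sum.elim_inr, one_mul, neg_one_mul, neg_mul, Finset.sum_neg_distrib,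
    ← Finset.mul_sum]
  ring

omit [Fintype σ] [DecidableEq σ] in
/-- The admissible range `KR I x` of `k = #α` is contained in `range (x c + 1)`. [folklore] -/
theorem KR_subset_range (x : σ →₀ ℕ) : KR I x ⊆ Finset.range (x I.c + 1) := by
  intro k hk
  rw [mem_KR] at hk
  exact Finset.mem_range.mpr (by omega)

/-- **THE COEFFICIENT THEOREM.** For a balanced exponent `x` whose reduced degree `n = deg x̂` lies in `[1, R]`, the coefficient of
`Y^x` in the Segre lift of the truncated logarithm is `(-1)^{n+1}/n · multinomial(x̂) · F(x_c; x̂)`. [folklore] -/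
theorem coeff_segre_logTrunc (c d : Fin m → σ → ℂ) (R : ℕ) (x : σ →₀ ℕ) (hx : Balanced I x)
    (h1 : 1 ≤ deg (xhat I x)) (hR : deg (xhat I x) ≤ R) :
    coeff x (phiT (segM I) (logTrunc c d R)) =
      ((-1 : ℂ) ^ (deg (xhat I x) + 1) / (deg (xhat I x) : ℂ)) * ((xhat I x).multinomial : ℂ) *
        Fsl I c d (x I.c) (xhat I x) := by
  classical
  rw [coeff_phiT]
  -- Step 1: reindex the fibre sum by `k = #α ∈ KR x`
  have step1 : ∑ L ∈ (logTrunc c d R).support with piT (segM I) L = x, coeff L (logTrunc c d R) =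
      ∑ k ∈ KR I x, coeff (Lof I x k) (logTrunc c d R) := by
    rw [← Finset.sum_filter_add_sum_filter_not (KR I x) (fun k => Lof I x k ∈ (logTrunc c d R).support)]
    rw [Finset.sum_eq_zero (s := (KR I x).filter fun k => ¬ Lof I x k ∈ (logTrunc c d R).support)
      (fun k hk => notMem_support_iff.mp (Finset.mem_filter.mp hk).2), add_zero]
    apply Finset.sum_nbij' (fun L => L I.a) (fun k => Lof I x k)
    · intro L hL
      rw [Finset.mem_filter] at hL
      obtain ⟨hk, hLeq⟩ := eq_Lof_of_piT I L x hL.2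
      rw [Finset.mem_filter, ← hLeq]
      exact ⟨hk, hL.1⟩
    · intro k hk
      rw [Finset.mem_filter] at hk
      rw [Finset.mem_filter]
      exact ⟨hk.2, piT_Lof I x hx k hk.1⟩
    · intro L hL
      rw [Finset.mem_filter] at hL
      exact (eq_Lof_of_piT I L x hL.2).2.symm
    · intro k _
      exact Lof_a I x k
    · intro L hL
      rw [Finset.mem_filter] at hL
      obtain ⟨-, hLeq⟩ := eq_Lof_of_piT I L x hL.2
      rw [← hLeq]
  rw [step1]
  -- Step 2: evaluate each fibre coefficient and regroup the multinomial
  have step2 : ∀ k ∈ KR I x, coeff (Lof I x k) (logTrunc c d R) =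
      ((-1 : ℂ) ^ (deg (xhat I x) + 1) / (deg (xhat I x) : ℂ)) * (((xhat I x).multinomial : ℂ) *
        ((((x I.a).choose k * (x I.b).choose (x I.c - k) : ℕ) : ℂ) *
          (∑ j, mom (c j) (Lof I x k) - ∑ j, mom (d j) (Lof I x k)))) := by
    intro k hk
    have hdeg := deg_Lof I x k hk
    rw [coeff_logTrunc c d R _ (by rw [hdeg]; exact h1) (by rw [hdeg]; exact hR), hdeg, multinomial_Lof I x k hk]
    push_cast; ring
  rw [Finset.sum_congr rfl step2, ← Finset.mul_sum, ← Finset.mul_sum, Fsl_xhat_eq]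
  -- Step 3: the binomial weights vanish off `KR x`
  rw [← Finset.sum_subset (KR_subset_range I x) (fun k hk hnk => by
    rw [mem_KR] at hnk
    have hk' : k ≤ x I.c := Nat.lt_succ_iff.mp (Finset.mem_range.mp hk)
    have : (x I.a).choose k * (x I.b).choose (x I.c - k) = 0 := by
      rcases Nat.lt_or_ge (x I.a) k with h | h
      · rw [Nat.choose_eq_zero_of_lt h, zero_mul]
      · have h2 : x I.b < x I.c - k := by omega
        rw [Nat.choose_eq_zero_of_lt h2, mul_zero]
    rw [this, Nat.cast_zero, zero_mul])]
  ring

/-- The support criterion: a balanced `x` with reduced degree in `[1, R]` lies in the support of the lifted truncated logarithm iff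
its slice sum does not vanish at `x̂`. [folklore] -/
theorem mem_support_segre_logTrunc_iff (c d : Fin m → σ → ℂ) (R : ℕ) (x : σ →₀ ℕ) (hx : Balanced I x)
    (h1 : 1 ≤ deg (xhat I x)) (hR : deg (xhat I x) ≤ R) :
    x ∈ (phiT (segM I) (logTrunc c d R)).support ↔ Fsl I c d (x I.c) (xhat I x) ≠ 0 := by
  rw [mem_support_iff, coeff_segre_logTrunc I c d R x hx h1 hR]
  have hk : (deg (xhat I x) : ℂ) ≠ 0 := Nat.cast_ne_zero.mpr (by omega)
  have hc : ((-1 : ℂ) ^ (deg (xhat I x) + 1) / (deg (xhat I x) : ℂ)) ≠ 0 :=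
    div_ne_zero (pow_ne_zero _ (neg_ne_zero.mpr one_ne_zero)) hk
  have hm := multinomial_cast_ne_zero (xhat I x)
  constructor
  · intro h hF; exact h (by rw [hF, mul_zero])
  · intro h; exact mul_ne_zero (mul_ne_zero hc hm) h

/-- Non-vanishing of a slice sum forces `ν_c = ν_d = 0` and `b ≤ ν_a + ν_b`. [folklore] -/
theorem shape_of_Fsl_ne_zero (c d : Fin m → σ → ℂ) (b : ℕ) (ν : σ → ℕ) (h : Fsl I c d b ν ≠ 0) :
    ν I.c = 0 ∧ ν I.d = 0 ∧ b ≤ ν I.a + ν I.b := by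
  by_contra hcon
  apply h
  unfold Fsl bsum
  refine Finset.sum_eq_zero fun τ _ => ?_
  rw [mul_eq_zero]; right
  have hAc : termA I c d b τ I.c = 0 := by simp [termA, I.hac.symm]
  have hAd : termA I c d b τ I.d = 0 := by simp [termA, I.had.symm]
  have hDa : termD I b τ I.a = (τ.2 : ℕ) := by simp [termD]
  have hDb : termD I b τ I.b = b - τ.2 := by simp [termD, I.hab.symm]
  have hDc : termD I b τ I.c = 0 := by simp [termD, I.hac.symm, I.hbc.symm]
  have hDd : termD I b τ I.d = 0 := by simp [termD, I.had.symm, I.hbd.symm]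
  by_cases hc : ν I.c = 0
  · by_cases hd : ν I.d = 0
    · have hlt : ν I.a + ν I.b < b := by omega
      rcases Nat.lt_or_ge (ν I.a) τ.2 with h1 | h1
      · exact Finset.prod_eq_zero (Finset.mem_univ I.a) (by rw [hDa]; exact binChar_eq_zero_of_lt _ _ _ h1)
      · exact Finset.prod_eq_zero (Finset.mem_univ I.b) (by rw [hDb]; exact binChar_eq_zero_of_lt _ _ _ (by omega))
    · exact Finset.prod_eq_zero (Finset.mem_univ I.d) (by rw [hAd, hDd, binChar_base_zero, if_neg hd])
  · exact Finset.prod_eq_zero (Finset.mem_univ I.c) (by rw [hAc, hDc, binChar_base_zero, if_neg hc])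

/-- The slice sum vanishes at the origin of the slice `b = 0` (equal numbers of `±` atoms). [folklore] -/
theorem Fsl_zero_zero (c d : Fin m → σ → ℂ) (ν : σ → ℕ) (hν : ∀ j, ν j = 0) : Fsl I c d 0 ν = 0 := by
  unfold Fsl bsum
  have : ∀ τ : SIdx m 0, termC I c d 0 τ * ∏ j, binChar (termA I c d 0 τ j) (termD I 0 τ j) (ν j) = sgn m τ.1 := by
    intro τ
    have hk : (τ.2 : ℕ) = 0 := by have := τ.2.isLt; omega
    have hprod : ∏ j, binChar (termA I c d 0 τ j) (termD I 0 τ j) (ν j) = 1 := by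
      refine Finset.prod_eq_one fun j _ => ?_
      have hD : termD I 0 τ j = 0 := by
        unfold termD; split_ifs <;> simp [hk]
      rw [hD, hν j]; simp [binChar]
    rw [hprod, mul_one]; unfold termC; rw [hk]; simp
  simp only [this]
  rw [Fintype.sum_prod_type, Fintype.sum_sum_type]
  simp [sgn]

/-- The balanced exponent with prescribed slice `b` and reduced part `ν` (`ν_c = ν_d = 0`, `b ≤ ν_a + ν_b`). [folklore] -/
def xOf (b : ℕ) (ν : σ → ℕ) : σ →₀ ℕ :=
  ofFun fun j => if j = I.c then b else if j = I.d then ν I.a + ν I.b - b else ν j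

/-- The `c`-coordinate of `xOf I b ν` is the prescribed slice `b`. [folklore] -/
theorem xOf_c (b : ℕ) (ν : σ → ℕ) : xOf I b ν I.c = b := by
  simp [xOf]

/-- `xOf I b ν` is balanced as soon as `b ≤ ν a + ν b`. [folklore] -/
theorem xOf_balanced (b : ℕ) (ν : σ → ℕ) (hb : b ≤ ν I.a + ν I.b) : Balanced I (xOf I b ν) := by
  unfold Balanced xOf
  simp [I.hac, I.had, I.hbc, I.hbd, I.hcd.symm]
  omega

/-- Reducing `xOf I b ν` gives back `ν` (when `ν c = ν d = 0`). [folklore] -/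
theorem xhat_xOf (b : ℕ) (ν : σ → ℕ) (hc : ν I.c = 0) (hd : ν I.d = 0) : ⇑(xhat I (xOf I b ν)) = ν := by
  funext j
  by_cases hjc : j = I.c
  · subst hjc; rw [xhat_c, hc]
  by_cases hjd : j = I.d
  · subst hjd; rw [xhat_d, hd]
  rw [xhat_other I _ j hjc hjd]
  simp [xOf, hjc, hjd]

/-- `xOf` with slice `x c` inverts the reduction `x̂` on balanced exponents. [folklore] -/
theorem xOf_xhat (x : σ →₀ ℕ) (hx : Balanced I x) : xOf I (x I.c) (xhat I x) = x := by
  unfold Balanced at hx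
  ext j
  by_cases hjc : j = I.c
  · subst hjc; rw [xOf_c]
  by_cases hjd : j = I.d
  · subst hjd; simp [xOf, I.hcd.symm, xhat_a, xhat_b]; omega
  simp [xOf, hjc, hjd, xhat_other I x j hjc hjd]

end Slice

/-! ## Part T5: Lemma A upstairs — strict minima of a toric lift of the chain are strict minima of the toric lift of the truncated
logarithm (generic Wronskian chain `strictMin_sub_iff_of_congr` + `coeff_wronskian_congr` with factors `1 + φ(lin c_j)`) -/

section LemmaA
variable {τ : Type*} [Fintype τ] [DecidableEq τ] (M : σ → (τ →₀ ℕ)) {m : ℕ}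

omit [DecidableEq σ] [Fintype τ] in
/-- The toric image of a linear form has zero constant term (no `M i` is zero). [folklore] -/
theorem coeff_zero_phiT_lin (hM : ∀ i, M i ≠ 0) (a : σ → ℂ) : coeff 0 (phiT M (lin a)) = 0 := by
  classical
  unfold lin
  rw [map_sum, coeff_sum]
  refine Finset.sum_eq_zero fun i _ => ?_
  rw [map_smul, phiT_X, coeff_smul, coeff_monomial, if_neg (hM i), smul_zero]

omit [DecidableEq σ] [Fintype τ] in
/-- The constant term of `1 + φ_M(lin a)` is `1` (no `M i` is zero). [folklore] -/
theorem coeff_zero_one_add_phiT_lin (hM : ∀ i, M i ≠ 0) (a : σ → ℂ) : coeff 0 (1 + phiT M (lin a)) = 1 := by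
  rw [coeff_add, coeff_zero_phiT_lin M hM, add_zero, coeff_zero_one]

omit [DecidableEq σ] [Fintype τ] [DecidableEq τ] in
/-- The toric push-forward of the lifted difference: `φ_M(liftG c d) = ∏_j (1 + φ_M(lin c_j)) - ∏_j (1 + φ_M(lin d_j))`. [folklore] -/
theorem phiT_liftG (c d : Fin m → σ → ℂ) :
    phiT M (liftG c d) = ∏ j, (1 + phiT M (lin (c j))) - ∏ j, (1 + phiT M (lin (d j))) := by
  unfold liftG
  simp only [map_sub, map_prod, map_add, map_one]

omit [DecidableEq σ] [Fintype τ] [DecidableEq τ] in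
/-- The toric push-forward of the truncated logarithm `logTrunc c d R`, term by term. [folklore] -/
theorem phiT_logTrunc (c d : Fin m → σ → ℂ) (R : ℕ) :
    phiT M (logTrunc c d R) = ∑ r ∈ Finset.Icc 1 R, ((-1 : ℂ) ^ (r + 1) / (r : ℂ)) •
      (∑ j, ((1 + phiT M (lin (c j))) - 1) ^ r - ∑ j, ((1 + phiT M (lin (d j))) - 1) ^ r) := by
  unfold logTrunc
  simp only [map_sum, map_smul, map_sub, map_pow, map_add, map_one]

omit [DecidableEq σ] in
/-- **Lemma A for a toric lift.** If `x₀` is a strict `θ`-minimum (`θ ≥ 1`) of the support of `φ_M(G)`, then it is a strict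
`θ`-minimum of the support of `φ_M(Λ_R)`, `R = ⌊θ(x₀)⌋ + 1`. [folklore] -/
theorem toric_minLog (hM : ∀ i, M i ≠ 0) (θ : τ → ℝ) (hθ : ∀ i, 1 ≤ θ i) (c d : Fin m → σ → ℂ) (x₀ : τ →₀ ℕ)
    (h : x₀ ∈ (phiT M (liftG c d)).support ∧ ∀ x ∈ (phiT M (liftG c d)).support, x ≠ x₀ → lwt θ x₀ < lwt θ x) :
    x₀ ∈ (phiT M (logTrunc c d (⌊lwt θ x₀⌋₊ + 1))).support ∧
      ∀ x ∈ (phiT M (logTrunc c d (⌊lwt θ x₀⌋₊ + 1))).support, x ≠ x₀ → lwt θ x₀ < lwt θ x := by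
  have hadd := lwt_add θ
  have hpos := one_le_lwt_of_ne_zero θ hθ
  set R : ℕ := ⌊lwt θ x₀⌋₊ + 1 with hRdef
  have hR : lwt θ x₀ < (R : ℝ) := by
    rw [hRdef]; push_cast; exact Nat.lt_floor_add_one _
  have hu : ∀ j, coeff 0 (1 + phiT M (lin (c j))) = 1 := fun j => coeff_zero_one_add_phiT_lin M hM (c j)
  have hv : ∀ j, coeff 0 (1 + phiT M (lin (d j))) = 1 := fun j => coeff_zero_one_add_phiT_lin M hM (d j)
  have key := strictMin_sub_iff_of_congr (lwt θ) hadd hpos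
    (MvPolynomial.mkDerivation ℂ fun i : τ => ((θ i : ℝ) : ℂ) • (X i : MvPolynomial τ ℂ))
    (coeff_eulerDerivation θ) (∏ j, (1 + phiT M (lin (c j)))) (∏ j, (1 + phiT M (lin (d j)))) _
    (coeff_zero_prod_eq_one _ hu) (coeff_zero_prod_eq_one _ hv) (coeff_zero_logTrunc _ _ hu hv R) R
    (coeff_wronskian_congr _ hadd hpos _ _ _ hu hv R) x₀ hR
  rw [← phiT_liftG, ← phiT_logTrunc] at key
  exact key.mp h

end LemmaA

end Summit.ValiantsHypothesis.ValiantsHypothesis.Theorems.NewtonUnitEquations.TwoProducts.PermutationType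

end
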